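import Literature.NumberTheory.Automorphic.JacquetRayFitting                       -- ★ p832364 (R2): `heckeRayEnd`, `heckeRayEnd_pow_apply_coe`, `finite_fixedPoints_of_isAdmissible`
import Literature.NumberTheory.Automorphic.JacquetRayExponents                     -- ★ p832687 (R2b): exponents ↔ non-zero spectrum of `T_a` [ED. 3]
import Literature.NumberTheory.Automorphic.CompactOpenAveraging                     -- ★ `exists_isLeftTransversal` (finite `S ⧸ (S ∩ H)`) [ED. 4]
import Literature.NumberTheory.Automorphic.MatrixCoefficients                      -- ★ `IsSquareIntegrableModCenter`, `matrixCoeff`, `contragredient`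
import Literature.LinearAlgebra.Matrix.MatrixNormNearSpectralRadiusQuantitative    -- ★ `Saloffcoste1997_lemma_1_2_5_fintype_pow` (`|(A^ℓ)_{ij}| ≤ C (ρ(A)+ε)^ℓ`)
import Literature.NumberTheory.Automorphic.SquareIntegrableOfShellDecay            -- ★ A-p13 (g27): `SphericalCoefficient.isSquareIntegrableModCenter_of_shellDecay_of_volume_le`
import Literature.NumberTheory.Automorphic.SquareIntegrableRayCoefficientDecay     -- ★ F0P3a-p04 (g10): `RayCoefficient.norm_sq_mul_lt_one`, `exists_invariant_form_apply_eq_one` [ED. 2]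
import Mathlib.MeasureTheory.Function.L2Space
import HarnessLib

/-!
# Casselman's square-integrability criterion in rank one, generic form (Casselman 1995, Thm. 4.4.6) — the assembly via the Hecke ray
# operator `T_a` on `V^K` (★ R1 `JacquetRayHeckeOperator`, ★ R2 `JacquetRayFitting`, ★ R2b `JacquetRayExponents`), no canonical pairing

Topic `NumberTheory/Automorphic`; namespace `Representation`.  THEOREMS ONLY (no definition, no named fact, no instance, no `sorry`).  Cell
`hodgecm-mathlib`, F0∕P3, seat F0P3-p01 (g10): file (R4) of the rank-one road to ★ `UnitaryGroup.U3SquareIntegrableExponents` [Casselman1995,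
Thm. 4.4.6]; the remaining inputs for `U(3)(L⁺_v)` (an Iwahori datum for the Borel, the Cartan decomposition ★ `exists_cartan_of_involution`, the
shell volumes `μ(K aᵐ K) = μ(K)·δ_B(a)⁻ᵐ`, and «exponents ↔ non-zero spectrum of `T_a`» via ★ R2) are supplied by the sequel files.

SETTING.  `G` a topological group, `ρ` an ADMISSIBLE representation of `G` on a complex vector space with unitary central character `ω`;
`Z = Z(G)`, `μZ` a measure on `G ⧸ Z` (Borel); `t = (P, M, N)` a parabolic triple with `N` closed; compact open subgroups `K` with an Iwahori
factorisation `K = (K ∩ N̄)(K ∩ M)(K ∩ N)` and `a ∈ M` dominant (`a (K ∩ N) a⁻¹ ⊆ K`, `a⁻¹ (K ∩ N̄) a ⊆ K ∩ N̄`, `[a, K ∩ M] = 1`), as in R1∕R2.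

RESULTS (ED. 1 = §1–§2, the «⇐» assembly; ED. 2 = §3, the «⇒» assembly over ★ `SquareIntegrableRayCoefficientDecay` (F0P3a-p04); ED. 3 = §4, both
directions in terms of EXPONENTS via ★ R2b `JacquetRayExponents` with the modulus identity `δ_P(a)·D = 1` as a hypothesis; by the cell's
no-duplicate rule the pure shell⇄`L²` estimates live in ★ `SquareIntegrableOfShellDecay` (A-p13) and there).
* §1 `exists_norm_apply_pow_le_of_hasEigenvalue` — finite-dimensional linear algebra: if every eigenvalue `c` of `T ∈ End(W)` has `‖c‖ < r` then
  `‖φ(T^m w)‖ ≤ C · r^m` (matrix of `T` in a basis + ★ Saloff-Coste's quantitative Gelfand bound) [Saloffcoste1997, (1.2.6)];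
  `exists_radius_of_hasEigenvalue` — a radius `r` with `r² D < 1` above all eigenvalues when each has `‖c‖² D < 1`.
* §2 `isSquareIntegrableModCenter_of_heckeRay_spectrum` — **DECAY ⇒ SQUARE-INTEGRABLE**: given a compact open `K₀` normalising a neighbourhood
  basis `K_n` of Iwahori-factorised compact open subgroups with `a ∈ M` dominant for each, the Cartan decomposition `G = ⋃ₘ K₀ aᵐ K₀ Z` with
  `μZ(K₀ aᵐ K₀ Z/Z) ≤ C Dᵐ`, and `‖c‖² D < 1` for every eigenvalue `c` of `T_a` on every `V^{K_n}`, the representation is square-integrable modulo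
  the centre (★ `IsSquareIntegrableModCenter`): on the shell `K₀aᵐK₀Z` a coefficient is `|φ'(T_a^m v')|` with `φ' = φ∘π(k₁)`, `v' = π(k₂)v` in FINITE
  `K₀`-orbits (★ R1 `apply_pow_apply_eq_apply_heckeRay_iterate`), `≤ B rᵐ` by §1, and ★ A-p13's
  `SphericalCoefficient.isSquareIntegrableModCenter_of_shellDecay_of_volume_le` turns geometric shell decay into an `L²` majorant.
* §3 (ED. 2) `norm_sq_mul_lt_one_of_isSquareIntegrableModCenter` — **SQUARE-INTEGRABLE ⇒ DECAY**: if the shells `K aᵐ K Z/Z` are pairwise disjoint of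
  measure `≥ c₀ Dᵐ`, every eigenvalue `c` of `T_a` on `V^K` of a square-integrable admissible `ρ` has `‖c‖² D < 1` (eigenvector + invariant form
  ★ `RayCoefficient.exists_invariant_form_apply_eq_one`, geometric ray coefficients by ★ R1, then ★ `RayCoefficient.norm_sq_mul_lt_one`).
With `D = [K ∩ N : a (K ∩ N) a⁻¹] = δ_P(a)⁻¹` and `c = δ_P(a)^{1/2} χ'(a)` for a normalised exponent `χ'` (★ R2b `JacquetRayExponents`),
`‖c‖² D < 1 ⇔ ‖χ'(a)‖ < 1`: Casselman's Thm. 4.4.6 for a maximal (= minimal) parabolic.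

## References
* [Casselman1995] W. Casselman, *Introduction to the theory of admissible representations of `p`-adic reductive groups* (draft 1 May 1995),
  §4.1, Thm. 4.4.6 p. 45, Prop. 1.4.4, Thm. 3.3.3.
* [BernsteinZelevinsky1976] I. N. Bernstein, A. V. Zelevinsky, Russian Math. Surveys 31:3 (1976), §3.18–3.19.
* [Saloffcoste1997] L. Saloff-Coste, *Lectures on finite Markov chains*, LNM 1665 (1997), §1.2.1 Lemma 1.2.5, §1.2.2 (1.2.6).
-/

set_option autoImplicit false

open scoped BigOperators Pointwise NNReal ENNReal
open MeasureTheory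

namespace Representation

section SpectralBound

/-- **Growth of the coefficients `φ(T^m w)` of a finite-dimensional endomorphism**: if every eigenvalue `c` of `T` has `‖c‖ < r`
(`r > 0`), then `‖φ(T^m w)‖ ≤ C · r^m` for all `m` — Gelfand's spectral-radius bound, here from the quantitative matrix-norm lemma ★
`Saloffcoste1997_lemma_1_2_5_fintype_pow` (`|(A^ℓ)_{ij}| ≤ C_A (ρ(A) + ε)^ℓ`) in a basis. [cite: Saloffcoste1997, §1.2.2 eq. (1.2.6) (p. 16)]
[cite: Casselman1995, Thm. 4.4.6 (proof)] -/
theorem exists_norm_apply_pow_le_of_hasEigenvalue {W : Type*} [AddCommGroup W] [Module ℂ W] [FiniteDimensional ℂ W]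
    (T : Module.End ℂ W) {r : ℝ} (hr0 : 0 < r) (hr : ∀ c : ℂ, T.HasEigenvalue c → ‖c‖ < r) (φ : Module.Dual ℂ W) (w : W) :
    ∃ C : ℝ, 0 ≤ C ∧ ∀ m : ℕ, ‖φ ((T ^ m) w)‖ ≤ C * r ^ m := by
  classical
  set b := Module.finBasis ℂ W with hb
  set A : Matrix (Fin (Module.finrank ℂ W)) (Fin (Module.finrank ℂ W)) ℂ := LinearMap.toMatrix b b T with hA
  -- the spectrum of `A` lies in the open disc of radius `r`
  have hfin : (spectrum ℂ A).Finite := Matrix.finite_spectrum A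
  have hspec : ∀ c ∈ spectrum ℂ A, ‖c‖ < r := by
    intro c hc
    rw [hA, LinearMap.spectrum_toMatrix] at hc
    exact hr c (Module.End.hasEigenvalue_iff_mem_spectrum.2 hc)
  obtain ⟨r', hr'0, hr'r, hr'spec⟩ : ∃ r' : ℝ, 0 ≤ r' ∧ r' < r ∧ ∀ c ∈ spectrum ℂ A, ‖c‖ ≤ r' := by
    by_cases hne : (spectrum ℂ A).Nonempty
    · obtain ⟨c₀, hc₀, hmax⟩ := Set.exists_max_image (spectrum ℂ A) (fun c => ‖c‖) hfin hne
      exact ⟨‖c₀‖, norm_nonneg _, hspec c₀ hc₀, hmax⟩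
    · exact ⟨0, le_rfl, hr0, fun c hc => (hne ⟨c, hc⟩).elim⟩
  have hρA : (spectralRadius ℂ A).toReal ≤ r' := by
    have h1 : spectralRadius ℂ A ≤ ENNReal.ofReal r' := by
      refine iSup₂_le fun c hc => ?_
      rw [ENNReal.ofReal, ENNReal.coe_le_coe]
      exact (Real.le_toNNReal_iff_coe_le hr'0).2 (hr'spec c hc)
    calc (spectralRadius ℂ A).toReal ≤ (ENNReal.ofReal r').toReal := ENNReal.toReal_mono ENNReal.ofReal_ne_top h1
      _ = r' := ENNReal.toReal_ofReal hr'0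
  set ε := r - (spectralRadius ℂ A).toReal with hε
  have hεpos : 0 < ε := by rw [hε]; linarith
  have hsum : (spectralRadius ℂ A).toReal + ε = r := by rw [hε]; ring
  set CA : ℝ := Real.sqrt (Fintype.card (Fin (Module.finrank ℂ W))) *
    (1 + Real.sqrt (∑ i, ∑ j, ‖A i j‖ ^ 2) / ε) ^ Fintype.card (Fin (Module.finrank ℂ W)) with hCA
  have hCA0 : 0 ≤ CA := by positivity
  have hentry : ∀ ℓ : ℕ, 1 ≤ ℓ → ∀ i j, ‖(A ^ ℓ) i j‖ ≤ CA * r ^ ℓ := fun ℓ hℓ i j => by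
    have h := Literature.LinearAlgebra.Matrix.Saloffcoste1997_lemma_1_2_5_fintype_pow A hεpos hℓ i j
    rwa [hsum] at h
  set Cφ : ℝ := ∑ i, ‖φ (b i)‖ with hCφ
  set Cw : ℝ := ∑ j, ‖b.repr w j‖ with hCw
  have hCw0 : 0 ≤ Cw := Finset.sum_nonneg fun j _ => norm_nonneg _
  refine ⟨max ‖φ w‖ (CA * Cw * Cφ), (norm_nonneg _).trans (le_max_left _ _), fun m => ?_⟩
  rcases Nat.eq_zero_or_pos m with rfl | hm
  · rw [pow_zero, pow_zero, Module.End.one_apply, mul_one]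
    exact le_max_left _ _
  -- coordinates of `T^m w`
  have hrepr : ∀ i, b.repr ((T ^ m) w) i = ∑ j, (A ^ m) i j * b.repr w j := by
    intro i
    have h := LinearMap.toMatrix_mulVec_repr b b (T ^ m) w
    rw [← LinearMap.toMatrix_pow, ← hA] at h
    rw [← congrFun h i]
    rfl
  have hcoord : ∀ i, ‖b.repr ((T ^ m) w) i‖ ≤ CA * r ^ m * Cw := by
    intro i
    rw [hrepr i]
    calc ‖∑ j, (A ^ m) i j * b.repr w j‖ ≤ ∑ j, ‖(A ^ m) i j * b.repr w j‖ := norm_sum_le _ _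
      _ = ∑ j, ‖(A ^ m) i j‖ * ‖b.repr w j‖ := by simp_rw [norm_mul]
      _ ≤ ∑ j, CA * r ^ m * ‖b.repr w j‖ :=
          Finset.sum_le_sum fun j _ => mul_le_mul_of_nonneg_right (hentry m hm i j) (norm_nonneg _)
      _ = CA * r ^ m * Cw := by rw [← Finset.mul_sum]
  have hφ : φ ((T ^ m) w) = ∑ i, b.repr ((T ^ m) w) i • φ (b i) := by
    conv_lhs => rw [← b.sum_repr ((T ^ m) w)]
    rw [map_sum]
    exact Finset.sum_congr rfl fun i _ => by rw [map_smul]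
  calc ‖φ ((T ^ m) w)‖ = ‖∑ i, b.repr ((T ^ m) w) i • φ (b i)‖ := by rw [hφ]
    _ ≤ ∑ i, ‖b.repr ((T ^ m) w) i • φ (b i)‖ := norm_sum_le _ _
    _ = ∑ i, ‖b.repr ((T ^ m) w) i‖ * ‖φ (b i)‖ := by simp_rw [norm_smul]
    _ ≤ ∑ i, (CA * r ^ m * Cw) * ‖φ (b i)‖ :=
        Finset.sum_le_sum fun i _ => mul_le_mul_of_nonneg_right (hcoord i) (norm_nonneg _)
    _ = CA * Cw * Cφ * r ^ m := by rw [← Finset.mul_sum]; ring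
    _ ≤ max ‖φ w‖ (CA * Cw * Cφ) * r ^ m := mul_le_mul_of_nonneg_right (le_max_right _ _) (pow_nonneg hr0.le _)

end SpectralBound

end Representation

namespace Representation

section Criterion

open Literature.NumberTheory.Automorphic MeasureTheory

variable {G V : Type*} [Group G] [TopologicalSpace G] [IsTopologicalGroup G] [AddCommGroup V] [Module ℂ V]
  {ρ : Representation ℂ G V}

/-- A radius separating the (finitely many) eigenvalues from the critical circle: if every eigenvalue `c` of `T` has `‖c‖² D < 1` then
for some `r > 0` with `r² D < 1` every eigenvalue has `‖c‖ < r`. [cite: Casselman1995, Thm. 4.4.6 (proof)] -/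
theorem exists_radius_of_hasEigenvalue {W : Type*} [AddCommGroup W] [Module ℂ W] [FiniteDimensional ℂ W] (T : Module.End ℂ W)
    {D : ℝ} (h : ∀ c : ℂ, T.HasEigenvalue c → ‖c‖ ^ 2 * D < 1) :
    ∃ r : ℝ, 0 < r ∧ r ^ 2 * D < 1 ∧ ∀ c : ℂ, T.HasEigenvalue c → ‖c‖ < r := by
  have hfin : (spectrum ℂ T).Finite := Module.End.finite_spectrum T
  -- `r₀ ≥ 0` dominating the eigenvalues with `r₀² D < 1`
  obtain ⟨r₀, hr₀0, hr₀D, hr₀⟩ : ∃ r₀ : ℝ, 0 ≤ r₀ ∧ r₀ ^ 2 * D < 1 ∧ ∀ c : ℂ, T.HasEigenvalue c → ‖c‖ ≤ r₀ := by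
    by_cases hne : (spectrum ℂ T).Nonempty
    · obtain ⟨c₀, hc₀, hmax⟩ := Set.exists_max_image (spectrum ℂ T) (fun c => ‖c‖) hfin hne
      exact ⟨‖c₀‖, norm_nonneg _, h c₀ (Module.End.hasEigenvalue_iff_mem_spectrum.2 hc₀),
        fun c hc => hmax c (Module.End.hasEigenvalue_iff_mem_spectrum.1 hc)⟩
    · exact ⟨0, le_rfl, by simp, fun c hc => (hne ⟨c, Module.End.hasEigenvalue_iff_mem_spectrum.1 hc⟩).elim⟩
  -- enlarge slightly inside the open set `{r | r² D < 1}`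
  have hopen : IsOpen {r : ℝ | r ^ 2 * D < 1} := isOpen_lt ((continuous_pow 2).mul continuous_const) continuous_const
  obtain ⟨δ, hδ, hball⟩ := Metric.isOpen_iff.1 hopen r₀ hr₀D
  refine ⟨r₀ + δ / 2, by positivity, hball ?_, fun c hc => (hr₀ c hc).trans_lt (by linarith)⟩
  rw [Metric.mem_ball, Real.dist_eq, show r₀ + δ / 2 - r₀ = δ / 2 by ring, abs_of_pos (by positivity)]
  linarith

/-- **CASSELMAN'S CRITERION, RANK ONE, DIRECTION «DECAY ⇒ SQUARE-INTEGRABLE»** (generic form).  Let `ρ` be admissible with unitary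
central character `ω`; `K₀` a compact open subgroup normalising a neighbourhood basis `K_n` of compact open subgroups, each with an
Iwahori factorisation `K_n = (K_n ∩ N̄)(K_n ∩ M)(K_n ∩ N)` for which `a ∈ M` is dominant; suppose the Cartan decomposition
`G = ⋃ₘ K₀ aᵐ K₀ · Z(G)` holds and the shells have measure `μ_{G/Z}(K₀ aᵐ K₀ Z/Z) ≤ C · Dᵐ`.  If for every `n` every eigenvalue `c` of the
Hecke ray operator `T_a` on `V^{K_n}` satisfies `‖c‖² D < 1`, then every smooth matrix coefficient of `ρ` is dominated by an `L²(G/Z)` function: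
`ρ` is square-integrable modulo the centre (★ `IsSquareIntegrableModCenter`).  Proof: `|⟨φ, π(k₁ aᵐ k₂ z) v⟩| = |φ'(T_a^m v')|` with
`φ' = φ ∘ π(k₁)`, `v' = π(k₂) v` running through FINITE sets (★ R1 `apply_pow_apply_eq_apply_heckeRay_iterate`), `≤ B rᵐ` by the spectral
bound (§1), and `q ↦ B r^{m₀(q)}` is in `L²` (§2). [cite: Casselman1995, Thm. 4.4.6] [cite: BernsteinZelevinsky1976, §3.19] -/
theorem isSquareIntegrableModCenter_of_heckeRay_spectrum [MeasurableSpace (G ⧸ Subgroup.center G)]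
    [BorelSpace (G ⧸ Subgroup.center G)] (μZ : Measure (G ⧸ Subgroup.center G)) (hρa : ρ.IsAdmissible)
    (ω : ↥(Subgroup.center G) →* ℂˣ) (hω : ∀ (z : ↥(Subgroup.center G)) (x : V), ρ (z : G) x = ((ω z : ℂˣ) : ℂ) • x)
    (hω1 : ∀ z, ‖((ω z : ℂˣ) : ℂ)‖ = 1)
    (t : ParabolicTriple G) (Nbar : Subgroup G) (hN : IsClosed (t.N : Set G))
    (K₀ : Subgroup G) (hK₀ : IsCompact (K₀ : Set G)) (hK₀o : IsOpen (K₀ : Set G))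
    (Kf : ℕ → Subgroup G) (hKc : ∀ n, IsCompact (Kf n : Set G)) (hKo : ∀ n, IsOpen (Kf n : Set G))
    (hKb : ∀ U ∈ nhds (1 : G), ∃ n, (Kf n : Set G) ⊆ U)
    (hKK₀ : ∀ n, ∀ k ∈ K₀, ∀ κ ∈ Kf n, k⁻¹ * κ * k ∈ Kf n)
    (hfac : ∀ n, (Kf n : Set G) =
      ((Kf n ⊓ Nbar : Subgroup G) : Set G) * ((Kf n ⊓ t.M : Subgroup G) : Set G) * ((Kf n ⊓ t.N : Subgroup G) : Set G))
    {a : G} (haM : ∀ n, ∀ m ∈ Kf n ⊓ t.M, m * a = a * m) (haN : ∀ n, ∀ x ∈ Kf n ⊓ t.N, a * x * a⁻¹ ∈ Kf n)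
    (haNbar : ∀ n, ∀ x ∈ Kf n ⊓ Nbar, a⁻¹ * x * a ∈ Kf n ⊓ Nbar)
    (hcartan : ∀ g : G, ∃ k₁ ∈ K₀, ∃ k₂ ∈ K₀, ∃ m : ℕ, ∃ z ∈ Subgroup.center G, g = k₁ * a ^ m * k₂ * z)
    {C D : ℝ} (hC : 0 ≤ C) (hD : 0 ≤ D)
    (hvol : ∀ m : ℕ, μZ (QuotientGroup.mk '' ((K₀ : Set G) * {a ^ m} * (K₀ : Set G))) ≤ ENNReal.ofReal (C * D ^ m))
    (hspec : ∀ (n : ℕ) (c : ℂ), Module.End.HasEigenvalue (ρ.heckeRayEnd (hKc n) hρa.1 a) c → ‖c‖ ^ 2 * D < 1) :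
    ρ.IsSquareIntegrableModCenter μZ := by
  classical
  -- Step 0: the shells `E m = K₀ aᵐ K₀ Z / Z` are open, of finite measure, and cover `G ⧸ Z`; reduce to geometric shell decay (★ A-p13)
  have hEopen : ∀ m : ℕ, IsOpen (QuotientGroup.mk '' ((K₀ : Set G) * {a ^ m} * (K₀ : Set G)) : Set (G ⧸ Subgroup.center G)) :=
    fun m => QuotientGroup.isOpenMap_coe _ ((hK₀o.mul_right).mul_right)
  have hcovE : ∀ q : G ⧸ Subgroup.center G, ∃ m : ℕ, q ∈ QuotientGroup.mk '' ((K₀ : Set G) * {a ^ m} * (K₀ : Set G)) := by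
    intro q
    obtain ⟨g, rfl⟩ := QuotientGroup.mk_surjective q
    obtain ⟨k₁, hk₁, k₂, hk₂, m, z, hz, hg⟩ := hcartan g
    refine ⟨m, k₁ * a ^ m * k₂, Set.mul_mem_mul (Set.mul_mem_mul hk₁ rfl) hk₂, ?_⟩
    rw [QuotientGroup.eq, hg, inv_mul_cancel_left]
    exact hz
  refine SphericalCoefficient.isSquareIntegrableModCenter_of_shellDecay_of_volume_le
    (S := fun m : ℕ => (QuotientGroup.mk '' ((K₀ : Set G) * {a ^ m} * (K₀ : Set G)) : Set (G ⧸ Subgroup.center G)))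
    (fun m => (hEopen m).measurableSet) (fun m => (hvol m).trans_lt ENNReal.ofReal_lt_top) hcovE hD (C' := C)
    (fun m => ENNReal.toReal_le_of_le_ofReal (by positivity) (hvol m)) fun φ hφ v => ?_
  -- Step 1: a common level `K = K_n` fixing `v` and `φ`
  have hvs : ρ.IsSmoothVector v := hρa.1 v
  have hφs : ρ.dual.IsSmoothVector φ := (ρ.mem_contragredient φ).1 hφ
  obtain ⟨n, hn⟩ := hKb _ (Filter.inter_mem (hvs.mem_nhds (ρ.stabilizerSubgroup v).one_mem)
    (hφs.mem_nhds (ρ.dual.stabilizerSubgroup φ).one_mem))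
  set K := Kf n with hKdef
  have hvK : ∀ κ ∈ K, ρ κ v = v := fun κ hκ => (ρ.mem_stabilizerSubgroup v κ).1 (hn hκ).1
  have hφK : ∀ κ ∈ K, ∀ x : V, φ (ρ κ x) = φ x := by
    intro κ hκ x
    have h1 : ρ.dual κ⁻¹ φ = φ := (ρ.dual.mem_stabilizerSubgroup φ κ⁻¹).1 (hn (K.inv_mem hκ)).2
    have h2 := LinearMap.congr_fun h1 x
    rwa [dual_apply, inv_inv, Module.Dual.transpose_apply, LinearMap.comp_apply] at h2
  -- Step 2: the finite `K₀`-orbits of `v` and `φ`; their members are `K`-fixed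
  have hS := JacquetLemma.finite_orbit_of_isSmoothVector ρ K₀ hK₀ subset_rfl hvs
  have hΦ := JacquetLemma.finite_orbit_of_isSmoothVector ρ.dual K₀ hK₀ subset_rfl hφs
  have hSfix : ∀ v' ∈ hS.toFinset, v' ∈ ρ.fixedPoints K := by
    intro v' hv'
    obtain ⟨k, hk, rfl⟩ := (Set.Finite.mem_toFinset hS).1 hv'
    refine (ρ.mem_fixedPoints K _).2 fun κ hκ => ?_
    have hmul : κ * k = k * (k⁻¹ * κ * k) := by group
    show ρ κ (ρ k v) = ρ k v
    rw [← Module.End.mul_apply, ← map_mul, hmul, map_mul, Module.End.mul_apply, hvK _ (hKK₀ n k hk κ hκ)]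
  have hΦfix : ∀ φ' ∈ hΦ.toFinset, ∀ κ ∈ K, ∀ x : V, φ' (ρ κ x) = φ' x := by
    intro φ' hφ' κ hκ x
    obtain ⟨k, hk, rfl⟩ := (Set.Finite.mem_toFinset hΦ).1 hφ'
    show (ρ.dual k φ) (ρ κ x) = (ρ.dual k φ) x
    rw [dual_apply, Module.Dual.transpose_apply, LinearMap.comp_apply, LinearMap.comp_apply, ← Module.End.mul_apply,
      ← map_mul]
    have hmul : k⁻¹ * κ = (k⁻¹ * κ * k) * k⁻¹ := by group
    rw [hmul, map_mul, Module.End.mul_apply, hφK _ (hKK₀ n k hk κ hκ)]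
  -- Step 3: a radius for `T_a` on `V^K`
  haveI : FiniteDimensional ℂ (ρ.fixedPoints K) := finite_fixedPoints_of_isAdmissible hρa (hKc n) (hKo n)
  obtain ⟨r, hr0, hrD, hr⟩ := exists_radius_of_hasEigenvalue (ρ.heckeRayEnd (hKc n) hρa.1 a) (hspec n)
  -- Step 4: per-pair constants, and their sum `B`
  have key : ∀ φ' ∈ hΦ.toFinset, ∀ v' ∈ hS.toFinset, ∃ Cpv : ℝ, 0 ≤ Cpv ∧
      ∀ m : ℕ, ‖φ' ((ρ.heckeRay K a)^[m] v')‖ ≤ Cpv * r ^ m := by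
    intro φ' hφ' v' hv'
    obtain ⟨Cpv, h0, hb⟩ := exists_norm_apply_pow_le_of_hasEigenvalue (ρ.heckeRayEnd (hKc n) hρa.1 a) hr0 hr
      (φ'.comp (ρ.fixedPoints K).subtype) ⟨v', hSfix v' hv'⟩
    refine ⟨Cpv, h0, fun m => ?_⟩
    have h := hb m
    rwa [LinearMap.comp_apply, Submodule.subtype_apply, heckeRayEnd_pow_apply_coe] at h
  choose! Cf hCf0 hCf using key
  set B : ℝ := ∑ φ' ∈ hΦ.toFinset, ∑ v' ∈ hS.toFinset, Cf φ' v' with hBdef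
  have hB0 : 0 ≤ B := Finset.sum_nonneg fun φ' hφ' => Finset.sum_nonneg fun v' hv' => hCf0 φ' hφ' v' hv'
  have hle_B : ∀ φ' ∈ hΦ.toFinset, ∀ v' ∈ hS.toFinset, Cf φ' v' ≤ B := by
    intro φ' hφ' v' hv'
    calc Cf φ' v' ≤ ∑ v'' ∈ hS.toFinset, Cf φ' v'' :=
          Finset.single_le_sum (f := fun v'' => Cf φ' v'') (fun v'' hv'' => hCf0 φ' hφ' v'' hv'') hv'
      _ ≤ B := Finset.single_le_sum (f := fun φ'' => ∑ v'' ∈ hS.toFinset, Cf φ'' v'')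
          (fun φ'' hφ'' => Finset.sum_nonneg fun v'' hv'' => hCf0 φ'' hφ'' v'' hv'') hφ'
  -- Step 5: pointwise domination on the shell `K₀ aᵐ K₀ Z`
  have hdom : ∀ (g : G) (m : ℕ), (g : G ⧸ Subgroup.center G) ∈
      QuotientGroup.mk '' ((K₀ : Set G) * {a ^ m} * (K₀ : Set G)) → ‖ρ.matrixCoeff φ v g‖ ≤ B * r ^ m := by
    intro g m hg
    obtain ⟨g', hg', hgg'⟩ := hg
    obtain ⟨x, hx, k₂, hk₂, rfl⟩ := Set.mem_mul.1 hg'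
    obtain ⟨k₁, hk₁, y, hy, rfl⟩ := Set.mem_mul.1 hx
    rw [Set.mem_singleton_iff] at hy
    subst hy
    have hz : (k₁ * a ^ m * k₂)⁻¹ * g ∈ Subgroup.center G := QuotientGroup.eq.1 hgg'
    set z := (k₁ * a ^ m * k₂)⁻¹ * g with hzdef
    have hg_eq : g = k₁ * a ^ m * k₂ * z := (mul_inv_cancel_left _ _).symm
    have hcoef : ρ.matrixCoeff φ v g = ((ω ⟨z, hz⟩ : ℂˣ) : ℂ) * (φ.comp (ρ k₁)) (ρ (a ^ m) (ρ k₂ v)) := by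
      show φ (ρ g v) = _
      rw [hg_eq, map_mul, map_mul, map_mul, Module.End.mul_apply, Module.End.mul_apply, Module.End.mul_apply,
        show ρ z v = ((ω ⟨z, hz⟩ : ℂˣ) : ℂ) • v from hω ⟨z, hz⟩ v, map_smul, map_smul, map_smul, map_smul, smul_eq_mul,
        LinearMap.comp_apply]
    have hφ'mem : φ.comp (ρ k₁) ∈ hΦ.toFinset := by
      rw [Set.Finite.mem_toFinset]
      refine ⟨k₁⁻¹, K₀.inv_mem hk₁, ?_⟩
      show ρ.dual k₁⁻¹ φ = φ.comp (ρ k₁)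
      rw [dual_apply, inv_inv, Module.Dual.transpose_apply]
    have hv'mem : ρ k₂ v ∈ hS.toFinset := by
      rw [Set.Finite.mem_toFinset]
      exact ⟨k₂, hk₂, rfl⟩
    rw [hcoef, norm_mul, hω1, one_mul,
      apply_pow_apply_eq_apply_heckeRay_iterate (hKc n) (hKo n) hN hρa.1 (hfac n) (haM n) (haN n) (haNbar n) _
        (hΦfix _ hφ'mem) (hSfix _ hv'mem) m]
    exact (hCf _ hφ'mem _ hv'mem m).trans (mul_le_mul_of_nonneg_right (hle_B _ hφ'mem _ hv'mem) (pow_nonneg hr0.le m))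
  -- Step 6: the shells `E m = K₀ aᵐ K₀ Z / Z` are open and cover `G/Z`
  exact ⟨B, r, hr0.le, hrD, fun m g hg => hdom g m hg⟩

/-! ## §3 (ED. 2) The «⇒» assembly: square-integrable ⇒ every eigenvalue of `T_a` on `V^K` has `‖c‖² D < 1` -/

/-- **CASSELMAN'S CRITERION, RANK ONE, DIRECTION «SQUARE-INTEGRABLE ⇒ DECAY»** (generic form).  Let `ρ` be admissible and square-integrable
modulo the centre (w.r.t. a measure finite on compacts), `K = (K ∩ N̄)(K ∩ M)(K ∩ N)` compact open with `a ∈ M` dominant; suppose the shells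
`K aᵐ K Z/Z` (`m ∈ ℕ`) are pairwise DISJOINT of measure `≥ c₀ · Dᵐ` (`c₀ > 0`).  Then every eigenvalue `c` of `T_a` on `V^K` satisfies `‖c‖² D < 1`:
for an eigenvector `v` and a `K`-invariant smooth form `φ` with `φ(v) = 1` (★ `RayCoefficient.exists_invariant_form_apply_eq_one`), the ray
coefficients are geometric, `φ(π(aᵐ) v) = φ(T_aᵐ v) = cᵐ φ(v)` (★ R1 `apply_pow_apply_eq_apply_heckeRay_iterate`), and ★ F0P3a-p04's
`RayCoefficient.norm_sq_mul_lt_one` concludes. [cite: Casselman1995, Thm. 4.4.6] [cite: BernsteinZelevinsky1976, §3.19] -/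
theorem norm_sq_mul_lt_one_of_isSquareIntegrableModCenter [MeasurableSpace (G ⧸ Subgroup.center G)]
    [BorelSpace (G ⧸ Subgroup.center G)] (μZ : Measure (G ⧸ Subgroup.center G)) [IsFiniteMeasureOnCompacts μZ] (hρa : ρ.IsAdmissible)
    (hsq : ρ.IsSquareIntegrableModCenter μZ)
    (t : ParabolicTriple G) (Nbar : Subgroup G) (hN : IsClosed (t.N : Set G)) {K : Subgroup G} (hK : IsCompact (K : Set G))
    (hKo : IsOpen (K : Set G))
    (hfac : (K : Set G) = ((K ⊓ Nbar : Subgroup G) : Set G) * ((K ⊓ t.M : Subgroup G) : Set G) * ((K ⊓ t.N : Subgroup G) : Set G))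
    {a : G} (haM : ∀ m ∈ K ⊓ t.M, m * a = a * m) (haN : ∀ x ∈ K ⊓ t.N, a * x * a⁻¹ ∈ K)
    (haNbar : ∀ x ∈ K ⊓ Nbar, a⁻¹ * x * a ∈ K ⊓ Nbar)
    {c₀ D : ℝ} (hc₀ : 0 < c₀) (hD : 0 ≤ D)
    (hvol : ∀ m : ℕ, c₀ * D ^ m ≤ μZ.real (QuotientGroup.mk '' DoubleCoset.doubleCoset (a ^ m) (K : Set G) K))
    (hdisj : Pairwise (Function.onFun Disjoint fun m : ℕ =>
      (QuotientGroup.mk : G → G ⧸ Subgroup.center G) '' DoubleCoset.doubleCoset (a ^ m) (K : Set G) K))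
    {c : ℂ} (hc : Module.End.HasEigenvalue (ρ.heckeRayEnd hK hρa.1 a) c) : ‖c‖ ^ 2 * D < 1 := by
  -- an eigenvector and a `K`-invariant smooth form with `φ(v) = 1`
  obtain ⟨v, hv⟩ := hc.exists_hasEigenvector
  have hv0 : (v : V) ≠ 0 := fun h => hv.2 (Subtype.ext h)
  obtain ⟨φ, hφmem, hφv, hφK⟩ := RayCoefficient.exists_invariant_form_apply_eq_one hρa.1 hK hKo v.2 hv0
  -- the ray coefficients are geometric
  have hT : ∀ m : ℕ, (ρ.heckeRay K a)^[m] (v : V) = c ^ m • (v : V) := by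
    intro m
    rw [← heckeRayEnd_pow_apply_coe hK hρa.1 a m v, hv.pow_apply m, Submodule.coe_smul]
  have hcoef : ∀ m : ℕ, φ (ρ (a ^ m) (v : V)) = c ^ m * φ (v : V) := by
    intro m
    rw [apply_pow_apply_eq_apply_heckeRay_iterate hK hKo hN hρa.1 hfac haM haN haNbar φ hφK v.2 m, hT m, map_smul, smul_eq_mul]
  exact RayCoefficient.norm_sq_mul_lt_one hsq hKo hK v.2 hφmem hφK (by rw [hφv]; exact one_ne_zero) hcoef hdisj hc₀ hD hvol


/-! ## §4 (ED. 3) The criterion in Casselman's terms: exponents of `r_P(π)` at the ray element `a` -/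

/-- **CASSELMAN'S CRITERION FOR EXPONENTS, «⇒»**: let `ρ` be admissible and square-integrable modulo the centre (measure finite on compacts), `𝓘` an
Iwahori datum for `t = (P, M, N)` (`N` closed) whose ray `a` is dominant at every level with `⋃ₘ a⁻ᵐ(K_n ∩ N)aᵐ = N`, whose shells
`K_n aᵐ K_n Z/Z` are pairwise disjoint of measure `≥ c₀ Dᵐ`, and suppose the MODULUS IDENTITY `δ_P(a) · D = 1` (i.e. `D = [K_n ∩ N : a(K_n ∩ N)a⁻¹]`,
★ `DoubleCosetHaarVolume` ∕ `CMBorelUnipotentIndexModulus`).  Then every exponent `χ'` of `r_P(ρ)` (★ `HasJacquetExponent`) satisfies `‖χ'(a)‖ < 1`.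
Proof: ★ R2b `exists_hasEigenvalue_heckeRayEnd_of_hasJacquetExponent` gives the eigenvalue `δ_P(a)^{1/2} χ'(a)` of `T_a` on some `V^{K_n}`, §3 gives
`‖δ_P(a)^{1/2} χ'(a)‖² D < 1`. [cite: Casselman1995, Thm. 4.4.6] -/
theorem norm_exponent_lt_one_of_isSquareIntegrableModCenter [MeasurableSpace (G ⧸ Subgroup.center G)]
    [BorelSpace (G ⧸ Subgroup.center G)] (μZ : Measure (G ⧸ Subgroup.center G)) [IsFiniteMeasureOnCompacts μZ] (hρa : ρ.IsAdmissible)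
    (hsq : ρ.IsSquareIntegrableModCenter μZ) (t : ParabolicTriple G) [LocallyCompactSpace ↥t.P] (𝓘 : t.IwahoriDatum)
    (hN : IsClosed (t.N : Set G))
    (haN : ∀ n, ∀ x ∈ 𝓘.K n ⊓ t.N, 𝓘.a * x * 𝓘.a⁻¹ ∈ 𝓘.K n)
    (haNbar : ∀ n, ∀ x ∈ 𝓘.K n ⊓ 𝓘.Nbar, 𝓘.a⁻¹ * x * 𝓘.a ∈ 𝓘.K n ⊓ 𝓘.Nbar)
    (hexh : ∀ n, ∀ x ∈ t.N, ∃ m : ℕ, ∀ m', m ≤ m' → 𝓘.a ^ m' * x * (𝓘.a ^ m')⁻¹ ∈ 𝓘.K n)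
    {D : ℝ} (hD : 0 ≤ D)
    (hvol : ∀ n : ℕ, ∃ c₀ : ℝ, 0 < c₀ ∧ ∀ m : ℕ,
      c₀ * D ^ m ≤ μZ.real (QuotientGroup.mk '' DoubleCoset.doubleCoset (𝓘.a ^ m) (𝓘.K n : Set G) (𝓘.K n)))
    (hdisj : ∀ n : ℕ, Pairwise (Function.onFun Disjoint fun m : ℕ =>
      (QuotientGroup.mk : G → G ⧸ Subgroup.center G) '' DoubleCoset.doubleCoset (𝓘.a ^ m) (𝓘.K n : Set G) (𝓘.K n)))
    (hδD : ‖((rootDeltaChar t.P ⟨𝓘.a, t.M_le 𝓘.a_mem⟩ : ℂˣ) : ℂ)‖ ^ 2 * D = 1)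
    {χ' : ↥t.M →* ℂˣ} (hχ : ρ.HasJacquetExponent t χ') : ‖((χ' ⟨𝓘.a, 𝓘.a_mem⟩ : ℂˣ) : ℂ)‖ < 1 := by
  obtain ⟨n, hn⟩ := exists_hasEigenvalue_heckeRayEnd_of_hasJacquetExponent t 𝓘 hN hρa haN haNbar hexh hχ
  obtain ⟨c₀, hc₀, hvol'⟩ := hvol n
  have h := norm_sq_mul_lt_one_of_isSquareIntegrableModCenter μZ hρa hsq t 𝓘.Nbar hN (𝓘.isCompact_K n) (𝓘.isOpen_K n)
    (𝓘.factorization n) (fun m hm => 𝓘.a_comm m (Subgroup.mem_inf.1 hm).2) (haN n) (haNbar n) hc₀ hD hvol' (hdisj n) hn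
  rw [norm_mul, mul_pow, mul_comm (‖((rootDeltaChar t.P ⟨𝓘.a, t.M_le 𝓘.a_mem⟩ : ℂˣ) : ℂ)‖ ^ 2), mul_assoc, hδD, mul_one] at h
  have h0 : 0 ≤ ‖((χ' ⟨𝓘.a, 𝓘.a_mem⟩ : ℂˣ) : ℂ)‖ := norm_nonneg _
  nlinarith

/-- **CASSELMAN'S CRITERION FOR EXPONENTS, «⇐»** (`M` abelian): let `ρ` be admissible with unitary central character `ω`, `𝓘` an Iwahori datum
(`N` closed, ray `a` dominant at every level, `⋃ₘ a⁻ᵐ(K_n ∩ N)aᵐ = N`, levels normalised by a compact open `K₀`), with the Cartan decomposition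
`G = ⋃ₘ K₀ aᵐ K₀ Z`, shell volumes `μZ(K₀ aᵐ K₀ Z/Z) ≤ C Dᵐ` and the modulus identity `δ_P(a) · D = 1`.  If every exponent `χ'` of `r_P(ρ)`
has `‖χ'(a)‖ < 1`, then `ρ` is square-integrable modulo the centre.  Proof: a non-zero eigenvalue `c` of `T_a` on `V^{K_n}` is
`δ_P(a)^{1/2} χ'(a)` for an exponent (★ R2b `exists_hasJacquetExponent_of_hasEigenvalue_heckeRayEnd`), so `‖c‖² D = ‖χ'(a)‖² < 1`; §2 concludes.
[cite: Casselman1995, Thm. 4.4.6] -/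
theorem isSquareIntegrableModCenter_of_forall_norm_exponent_lt_one [MeasurableSpace (G ⧸ Subgroup.center G)]
    [BorelSpace (G ⧸ Subgroup.center G)] (μZ : Measure (G ⧸ Subgroup.center G)) (hρa : ρ.IsAdmissible)
    (ω : ↥(Subgroup.center G) →* ℂˣ) (hω : ∀ (z : ↥(Subgroup.center G)) (x : V), ρ (z : G) x = ((ω z : ℂˣ) : ℂ) • x)
    (hω1 : ∀ z, ‖((ω z : ℂˣ) : ℂ)‖ = 1)
    (t : ParabolicTriple G) [LocallyCompactSpace ↥t.P] (𝓘 : t.IwahoriDatum) (hN : IsClosed (t.N : Set G))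
    (hMc : ∀ a b : ↥t.M, a * b = b * a)
    (K₀ : Subgroup G) (hK₀ : IsCompact (K₀ : Set G)) (hK₀o : IsOpen (K₀ : Set G))
    (hKK₀ : ∀ n, ∀ k ∈ K₀, ∀ κ ∈ 𝓘.K n, k⁻¹ * κ * k ∈ 𝓘.K n)
    (haN : ∀ n, ∀ x ∈ 𝓘.K n ⊓ t.N, 𝓘.a * x * 𝓘.a⁻¹ ∈ 𝓘.K n)
    (haNbar : ∀ n, ∀ x ∈ 𝓘.K n ⊓ 𝓘.Nbar, 𝓘.a⁻¹ * x * 𝓘.a ∈ 𝓘.K n ⊓ 𝓘.Nbar)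
    (hexh : ∀ n, ∀ x ∈ t.N, ∃ m : ℕ, ∀ m', m ≤ m' → 𝓘.a ^ m' * x * (𝓘.a ^ m')⁻¹ ∈ 𝓘.K n)
    (hcartan : ∀ g : G, ∃ k₁ ∈ K₀, ∃ k₂ ∈ K₀, ∃ m : ℕ, ∃ z ∈ Subgroup.center G, g = k₁ * 𝓘.a ^ m * k₂ * z)
    {C D : ℝ} (hC : 0 ≤ C) (hD : 0 ≤ D)
    (hvol : ∀ m : ℕ, μZ (QuotientGroup.mk '' ((K₀ : Set G) * {𝓘.a ^ m} * (K₀ : Set G))) ≤ ENNReal.ofReal (C * D ^ m))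
    (hδD : ‖((rootDeltaChar t.P ⟨𝓘.a, t.M_le 𝓘.a_mem⟩ : ℂˣ) : ℂ)‖ ^ 2 * D = 1)
    (hexp : ∀ χ' : ↥t.M →* ℂˣ, ρ.HasJacquetExponent t χ' → ‖((χ' ⟨𝓘.a, 𝓘.a_mem⟩ : ℂˣ) : ℂ)‖ < 1) :
    ρ.IsSquareIntegrableModCenter μZ := by
  refine isSquareIntegrableModCenter_of_heckeRay_spectrum μZ hρa ω hω hω1 t 𝓘.Nbar hN K₀ hK₀ hK₀o 𝓘.K 𝓘.isCompact_K 𝓘.isOpen_K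
    𝓘.hasBasis_K hKK₀ 𝓘.factorization (fun n m hm => 𝓘.a_comm m (Subgroup.mem_inf.1 hm).2) haN haNbar hcartan hC hD hvol
    fun n c hc => ?_
  by_cases hc0 : c = 0
  · rw [hc0, norm_zero, zero_pow two_ne_zero, zero_mul]; exact zero_lt_one
  obtain ⟨χ', hχ', hcχ⟩ := exists_hasJacquetExponent_of_hasEigenvalue_heckeRayEnd t 𝓘 hN hρa hMc haN haNbar hexh n hc0 hc
  rw [← hcχ, norm_mul, mul_pow, mul_comm (‖((rootDeltaChar t.P ⟨𝓘.a, t.M_le 𝓘.a_mem⟩ : ℂˣ) : ℂ)‖ ^ 2), mul_assoc, hδD, mul_one]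
  have h1 := hexp χ' hχ'
  have h0 : 0 ≤ ‖((χ' ⟨𝓘.a, 𝓘.a_mem⟩ : ℂˣ) : ℂ)‖ := norm_nonneg _
  nlinarith


/-! ## §5 (ED. 4) Characters on compact torus elements; the «⇐» criterion along a ray whose SQUARE is admissible -/

/-- **A character trivial on an open subgroup has modulus one on every compact subgroup**: if `ψ : T →* ℂˣ` is `1` on the open subgroup `H`
and `k` lies in a compact subgroup `S`, then `‖ψ(k)‖ = 1` — `S ⧸ (S ∩ H)` is finite (★ `exists_isLeftTransversal`), so two of the powers
`k, k², …` lie in one coset and `ψ(k)^d = 1` for some `d ≥ 1`. [cite: Casselman1995, Thm. 4.4.6 (proof); Prop. 2.1.9] -/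
theorem norm_apply_eq_one_of_mem_of_isCompact {T : Type*} [Group T] [TopologicalSpace T] [IsTopologicalGroup T] (ψ : T →* ℂˣ)
    {S H : Subgroup T} (hS : IsCompact (S : Set T)) (hH : IsOpen (H : Set T)) (hψ : ∀ h ∈ H, ψ h = 1) {k : T} (hk : k ∈ S) :
    ‖((ψ k : ℂˣ) : ℂ)‖ = 1 := by
  classical
  obtain ⟨R, hR⟩ := Literature.NumberTheory.Automorphic.exists_isLeftTransversal hS hH
  -- the representatives of the powers `k^i`, `i ≤ |R|`, cannot all differ
  let f : ℕ → T := fun i => hR.rep (k ^ i)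
  have hf : ∀ i ∈ Finset.range (R.card + 1), f i ∈ R := fun i _ => hR.rep_mem (S.pow_mem hk i)
  obtain ⟨i, hi, j, hj, hij, hfij⟩ := Finset.exists_ne_map_eq_of_card_lt_of_maps_to (by simp) hf
  -- WLOG `i < j`; then `k^(j-i) ∈ H`
  wlog hlt : i < j generalizing i j
  · exact this j hj i hi (Ne.symm hij) hfij.symm (lt_of_le_of_ne (not_lt.1 hlt) (Ne.symm hij))
  have hmem : (k ^ i)⁻¹ * k ^ j ∈ H := by
    have h1 : (f i)⁻¹ * k ^ i ∈ S ⊓ H := hR.rep_inv_mul_mem (S.pow_mem hk i)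
    have h2 : (f j)⁻¹ * k ^ j ∈ S ⊓ H := hR.rep_inv_mul_mem (S.pow_mem hk j)
    have h3 : ((f i)⁻¹ * k ^ i)⁻¹ * ((f j)⁻¹ * k ^ j) ∈ S ⊓ H := (S ⊓ H).mul_mem ((S ⊓ H).inv_mem h1) h2
    have hre : ((f i)⁻¹ * k ^ i)⁻¹ * ((f j)⁻¹ * k ^ j) = (k ^ i)⁻¹ * k ^ j := by rw [hfij]; group
    rw [hre] at h3
    exact (Subgroup.mem_inf.1 h3).2
  have hpow : (k ^ i)⁻¹ * k ^ j = k ^ (j - i) := by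
    rw [inv_mul_eq_iff_eq_mul, ← pow_add, Nat.add_sub_cancel' hlt.le]
  rw [hpow] at hmem
  have h1 : ((ψ k : ℂˣ) : ℂ) ^ (j - i) = 1 := by
    rw [← Units.val_pow_eq_pow_val, ← map_pow, hψ _ hmem, Units.val_one]
  have h2 : ‖((ψ k : ℂˣ) : ℂ)‖ ^ (j - i) = 1 := by rw [← norm_pow, h1, norm_one]
  exact (pow_eq_one_iff_of_nonneg (norm_nonneg _) (Nat.sub_ne_zero_of_lt hlt)).1 h2

/-- **CASSELMAN'S CRITERION FOR EXPONENTS, «⇐», ALONG A RAY WHOSE SQUARE IS ADMISSIBLE** (`M` abelian).  As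
`isSquareIntegrableModCenter_of_forall_norm_exponent_lt_one`, but the exponent hypothesis is made at an element `b` with `a² = b · k`, `k` in a
compact subgroup `S` of `M` on which `δ_P^{1/2}` has modulus `1` at `k`: then `‖χ'(b)‖ < 1` for every exponent `χ'` already gives square-integrability.
(For `U(3)(L⁺_v)` at a RAMIFIED place the Cartan ray `a = d(ϖ, 1, (σϖ)⁻¹)` is not of the printed shape `d(α, 1, ᾱ⁻¹)`, `α ∈ F`, but
`a² = d(ϖσϖ, 1, (ϖσϖ)⁻¹) · d(ϖ/σϖ, 1, ϖ/σϖ)` is such a `b` times a unit `k`.)  Proof: a non-zero eigenvalue `c` of `T_a` on `V^{K_n}` is `ψ(a)`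
for the UNNORMALISED character `ψ = χ' δ_P^{1/2}` of an exponent, trivial on `K_n ∩ M` (★ R2b `exists_hasJacquetExponent_of_hasEigenvalue_heckeRayEnd'`),
so `‖ψ(k)‖ = 1` (`norm_apply_eq_one_of_mem_of_isCompact`) and `‖c‖² D = ‖ψ(b)‖ D = ‖χ'(b)‖ δ_P(a) D = ‖χ'(b)‖ < 1`. [cite: Casselman1995, Thm. 4.4.6] -/
theorem isSquareIntegrableModCenter_of_forall_norm_exponent_lt_one_of_sq [MeasurableSpace (G ⧸ Subgroup.center G)]
    [BorelSpace (G ⧸ Subgroup.center G)] (μZ : Measure (G ⧸ Subgroup.center G)) (hρa : ρ.IsAdmissible)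
    (ω : ↥(Subgroup.center G) →* ℂˣ) (hω : ∀ (z : ↥(Subgroup.center G)) (x : V), ρ (z : G) x = ((ω z : ℂˣ) : ℂ) • x)
    (hω1 : ∀ z, ‖((ω z : ℂˣ) : ℂ)‖ = 1)
    (t : ParabolicTriple G) [LocallyCompactSpace ↥t.P] (𝓘 : t.IwahoriDatum) (hN : IsClosed (t.N : Set G))
    (hMc : ∀ a b : ↥t.M, a * b = b * a)
    (K₀ : Subgroup G) (hK₀ : IsCompact (K₀ : Set G)) (hK₀o : IsOpen (K₀ : Set G))
    (hKK₀ : ∀ n, ∀ k ∈ K₀, ∀ κ ∈ 𝓘.K n, k⁻¹ * κ * k ∈ 𝓘.K n)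
    (haN : ∀ n, ∀ x ∈ 𝓘.K n ⊓ t.N, 𝓘.a * x * 𝓘.a⁻¹ ∈ 𝓘.K n)
    (haNbar : ∀ n, ∀ x ∈ 𝓘.K n ⊓ 𝓘.Nbar, 𝓘.a⁻¹ * x * 𝓘.a ∈ 𝓘.K n ⊓ 𝓘.Nbar)
    (hexh : ∀ n, ∀ x ∈ t.N, ∃ m : ℕ, ∀ m', m ≤ m' → 𝓘.a ^ m' * x * (𝓘.a ^ m')⁻¹ ∈ 𝓘.K n)
    (hcartan : ∀ g : G, ∃ k₁ ∈ K₀, ∃ k₂ ∈ K₀, ∃ m : ℕ, ∃ z ∈ Subgroup.center G, g = k₁ * 𝓘.a ^ m * k₂ * z)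
    {C D : ℝ} (hC : 0 ≤ C) (hD : 0 ≤ D)
    (hvol : ∀ m : ℕ, μZ (QuotientGroup.mk '' ((K₀ : Set G) * {𝓘.a ^ m} * (K₀ : Set G))) ≤ ENNReal.ofReal (C * D ^ m))
    (hδD : ‖((rootDeltaChar t.P ⟨𝓘.a, t.M_le 𝓘.a_mem⟩ : ℂˣ) : ℂ)‖ ^ 2 * D = 1)
    (b k : ↥t.M) (hbk : (⟨𝓘.a, 𝓘.a_mem⟩ : ↥t.M) ^ 2 = b * k) (S : Subgroup ↥t.M) (hS : IsCompact (S : Set ↥t.M)) (hkS : k ∈ S)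
    (hδk : ‖((rootDeltaChar t.P (Subgroup.inclusion t.M_le k) : ℂˣ) : ℂ)‖ = 1)
    (hexp : ∀ χ' : ↥t.M →* ℂˣ, ρ.HasJacquetExponent t χ' → ‖((χ' b : ℂˣ) : ℂ)‖ < 1) :
    ρ.IsSquareIntegrableModCenter μZ := by
  refine isSquareIntegrableModCenter_of_heckeRay_spectrum μZ hρa ω hω hω1 t 𝓘.Nbar hN K₀ hK₀ hK₀o 𝓘.K 𝓘.isCompact_K 𝓘.isOpen_K
    𝓘.hasBasis_K hKK₀ 𝓘.factorization (fun n m hm => 𝓘.a_comm m (Subgroup.mem_inf.1 hm).2) haN haNbar hcartan hC hD hvol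
    fun n c hc => ?_
  by_cases hc0 : c = 0
  · rw [hc0, norm_zero, zero_pow two_ne_zero, zero_mul]; exact zero_lt_one
  obtain ⟨χ', hχ', hcχ, htriv⟩ := exists_hasJacquetExponent_of_hasEigenvalue_heckeRayEnd' t 𝓘 hN hρa hMc haN haNbar hexh n hc0 hc
  -- the unnormalised character `ψ = χ' · δ^{1/2}`
  set ψ : ↥t.M →* ℂˣ := χ' * (rootDeltaChar t.P).comp (Subgroup.inclusion t.M_le) with hψdef
  have hψ_apply : ∀ m : ↥t.M, ((ψ m : ℂˣ) : ℂ) = ((χ' m : ℂˣ) : ℂ) * ((rootDeltaChar t.P (Subgroup.inclusion t.M_le m) : ℂˣ) : ℂ) :=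
    fun m => by rw [hψdef, MonoidHom.mul_apply, Units.val_mul, MonoidHom.comp_apply]
  -- `ψ` is trivial on the open subgroup `K_n ∩ M`, hence of modulus `1` at `k ∈ S`
  have hopen : IsOpen (((𝓘.K n).comap t.M.subtype : Subgroup ↥t.M) : Set ↥t.M) :=
    (𝓘.isOpen_K n).preimage continuous_subtype_val
  have hψK : ∀ m ∈ ((𝓘.K n).comap t.M.subtype : Subgroup ↥t.M), ψ m = 1 := fun m hm =>
    Units.ext (by rw [hψ_apply, htriv m (Subgroup.mem_comap.1 hm), Units.val_one])
  have hψk : ‖((ψ k : ℂˣ) : ℂ)‖ = 1 := norm_apply_eq_one_of_mem_of_isCompact ψ hS hopen hψK hkS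
  -- `c = ψ(a)` and `c² = ψ(b) ψ(k)`
  have hca : c = ((ψ ⟨𝓘.a, 𝓘.a_mem⟩ : ℂˣ) : ℂ) := by rw [hψ_apply, mul_comm]; exact hcχ.symm
  have hc2 : c ^ 2 = ((ψ b : ℂˣ) : ℂ) * ((ψ k : ℂˣ) : ℂ) := by
    rw [hca, ← Units.val_pow_eq_pow_val, ← map_pow, hbk, map_mul, Units.val_mul]
  -- norms: `‖c‖² = ‖χ'(b)‖ · ‖δ^{1/2}(b)‖` and `‖δ^{1/2}(b)‖ = ‖δ^{1/2}(a)‖²`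
  have hδb : ‖((rootDeltaChar t.P (Subgroup.inclusion t.M_le b) : ℂˣ) : ℂ)‖ =
      ‖((rootDeltaChar t.P ⟨𝓘.a, t.M_le 𝓘.a_mem⟩ : ℂˣ) : ℂ)‖ ^ 2 := by
    have h1 : (rootDeltaChar t.P).comp (Subgroup.inclusion t.M_le) ((⟨𝓘.a, 𝓘.a_mem⟩ : ↥t.M) ^ 2) =
        (rootDeltaChar t.P).comp (Subgroup.inclusion t.M_le) b * (rootDeltaChar t.P).comp (Subgroup.inclusion t.M_le) k := by
      rw [hbk, map_mul]
    rw [map_pow] at h1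
    have h2 := congrArg (fun u : ℂˣ => ‖(u : ℂ)‖) h1
    simp only [MonoidHom.comp_apply, Units.val_pow_eq_pow_val, Units.val_mul, norm_pow, norm_mul, hδk, mul_one] at h2
    rw [← h2]
    rfl
  have hnorm : ‖c‖ ^ 2 * D = ‖((χ' b : ℂˣ) : ℂ)‖ := by
    rw [← norm_pow, hc2, norm_mul, hψk, mul_one, hψ_apply, norm_mul, hδb, mul_assoc, hδD, mul_one]
  rw [hnorm]
  exact hexp χ' hχ'


end Criterion

end Representation
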